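import Mathlib
import Summits.NavierStokesRegularity.NavierStokesRegularity.Theorems.EulerZoomLiouvillePowerGaugeEulerLiouvilleCondenserCircleMeanDerivative

/-!
# THEOREM G — CONDENSER PYTHAGORAS (plate t46-G, nsreg-p2 g34/g35 ROUND-44 §3 (G), `r44/Sketch44b.lean`
`NsregP2.R44.CondenserPythagoras`)

Width piece for crux `EulerZoomLiouville.PowerGaugeEulerLiouville` (stmt-NavierStokesRegularity-19832), by name under
LEAD 19832 (ns-typeII-p2 g13); seat ns-sfl-p1 g6, `--supports stmt-NavierStokesRegularity-19832 --as helper`.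
A self-contained planar identity — no flow, no profile: on an annulus the Dirichlet energy of a `C¹` scalar splits
orthogonally into the capacity term of its circular mean, the radial deviation of the mean from the logarithmic profile,
and the energy of the non-radial part.

* `condenserPythagoras` — the Sketch44b text VERBATIM: for `φ ∈ C¹(ℂ,ℝ)`, `0 < w < r`, `m(ρ) = ⨍_{‖z‖=ρ} φ`
  (`Real.circleAverage φ 0 ρ`), `Λ = log(r/w)`, `Δ = m(w) − m(r)`:
  `ℰ_{w,r}[φ] = 2πΔ²/Λ + 2π ∫_w^r (ρ·deriv m ρ + Δ/Λ)² dρ/ρ + ℰ_{w,r}[φ − m∘‖·‖]`;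
  `condenserPythagoras_explicit` — the same with the `let`s unfolded;
* `annulusEnergy_eq_radial_add_deviation` — `ℰ[φ] = 2π∫_w^r ρ m′(ρ)² dρ + ℰ[φ − m∘‖·‖]`;
* `radial_energy_identity` — the 1-D identity `∫_w^r ρ m′² = Δ²/Λ + ∫_w^r (ρm′ + Δ/Λ)²/ρ`;
* `measurableSet_annulus`, `isCompact_annulus`.

ROUTE: `m` is differentiable in the radius with `m′(ρ) = (2π)⁻¹∫_0^{2π} Dφ(ρe^{iθ})[e^{iθ}] dθ`
(`Condenser.hasDerivAt_circleAverage_radius`, differentiation under the integral sign); pointwise on the annulus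
`‖Dφ(z)‖² = ‖D(φ − m∘‖·‖)(z)‖² + 2m′(‖z‖)·Dφ(z)[z/‖z‖] − m′(‖z‖)²` (Riesz representation on the real inner-product plane
`ℂ`, `Condenser.opNorm_sq_eq_sub_radial`, `Condenser.fderiv_sub_radial`); the annulus integral of the last two terms is
`2π∫_w^r ρ · ⨍_{S_ρ}(2m′∂_ρφ − m′²) dρ = 2π∫_w^r ρ m′(ρ)² dρ` (`Condenser.annulusIntegral_eq_integral_mul_circleAverage`,
the cross term collapsing because `⨍_{S_ρ} ∂_ρφ = m′(ρ)`; the integrands are made globally continuous by clamping the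
radius below at `w`); finally `∫_w^r m′ = m(r) − m(w) = −Δ` and `∫_w^r ρ⁻¹ = Λ` give the 1-D identity.

READING (ROUND-44 §3): `ℰ ≤ (1+ε)·2πΔ²/Λ` forces both deviation terms `≤ ε·2πΔ²/Λ` — a budget-saturating sheath is
logarithmic in energy norm (equality-case stability of every capacity count in the tree).
HONEST FRAMING: plane calculus; proves nothing about the crux E (19832 OPEN), any door Target, or Navier–Stokes
regularity; no summit statement is touched. [nsreg-p2 ROUND-44 THEOREM G; folklore]
-/

noncomputable section

open Set Filter Topology Metric Function MeasureTheory intervalIntegral Complex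
open scoped Real NNReal ENNReal Interval RealInnerProductSpace

set_option linter.dupNamespace false

namespace Summit.NavierStokesRegularity.NavierStokesRegularity.Theorems.PowerGaugeEulerLiouville.Condenser

/-! ## §1 The annulus is a compact measurable set -/

/-- The closed annulus `{w ≤ ‖z‖ ≤ r}` as a preimage of `Icc w r` under the norm. [folklore] -/
theorem annulus_eq_preimage (w r : ℝ) :
    {z : ℂ | w ≤ ‖z‖ ∧ ‖z‖ ≤ r} = (fun z : ℂ => ‖z‖) ⁻¹' Icc w r := by
  ext z; simp [mem_Icc]

/-- The closed annulus is measurable. [folklore] -/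
theorem measurableSet_annulus (w r : ℝ) : MeasurableSet {z : ℂ | w ≤ ‖z‖ ∧ ‖z‖ ≤ r} := by
  rw [annulus_eq_preimage]
  exact continuous_norm.measurable measurableSet_Icc

/-- The closed annulus is compact. [folklore] -/
theorem isCompact_annulus (w r : ℝ) : IsCompact {z : ℂ | w ≤ ‖z‖ ∧ ‖z‖ ≤ r} := by
  refine (isCompact_closedBall (0 : ℂ) r).of_isClosed_subset ?_ ?_
  · rw [annulus_eq_preimage]; exact isClosed_Icc.preimage continuous_norm
  · intro z hz; exact mem_closedBall_zero_iff.2 hz.2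

/-! ## §2 The energy splits into the radial part and the deviation -/

/-- **Energy split.**  For `φ ∈ C¹(ℂ,ℝ)`, `0 < w ≤ r`, `m(ρ) = ⨍_{‖z‖=ρ} φ` and
`m′(ρ) = (2π)⁻¹∫_0^{2π} Dφ(ρe^{iθ})[e^{iθ}] dθ`:
`∫_{w ≤ ‖z‖ ≤ r} ‖Dφ‖² = 2π ∫_w^r ρ m′(ρ)² dρ + ∫_{w ≤ ‖z‖ ≤ r} ‖D(φ − m∘‖·‖)‖²`
(pointwise polar split `‖Dφ‖² = ‖D(φ − m∘‖·‖)‖² + 2m′∂_ρφ − m′²`, and the angular mean of `2m′∂_ρφ − m′²` on the circle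
of radius `ρ` is `m′(ρ)²`; the cross term vanishes because `⨍ ∂_ρφ = m′`). [nsreg-p2 ROUND-44 THEOREM G; folklore] -/
theorem annulusEnergy_eq_radial_add_deviation {φ : ℂ → ℝ} (hφ : ContDiff ℝ 1 φ) {w r : ℝ} (hw : 0 < w)
    (hwr : w ≤ r) :
    ∫ z in {z : ℂ | w ≤ ‖z‖ ∧ ‖z‖ ≤ r}, ‖fderiv ℝ φ z‖ ^ 2 =
      2 * π * (∫ ρ in w..r,
          ρ * ((2 * π)⁻¹ * ∫ θ in (0 : ℝ)..2 * π, fderiv ℝ φ (circleMap 0 ρ θ) (circleMap 0 1 θ)) ^ 2)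
        + ∫ z in {z : ℂ | w ≤ ‖z‖ ∧ ‖z‖ ≤ r}, ‖fderiv ℝ (fun z => φ z - Real.circleAverage φ 0 ‖z‖) z‖ ^ 2 := by
  have hπ : 0 < π := Real.pi_pos
  have h2π : (2 : ℝ) * π ≠ 0 := by positivity
  have hφd : Differentiable ℝ φ := hφ.differentiable one_ne_zero
  have hDc : Continuous (fderiv ℝ φ) := hφ.continuous_fderiv one_ne_zero
  -- the radial derivative of the mean, named opaquely
  obtain ⟨M, hM⟩ : ∃ M : ℝ → ℝ,
      M = fun ρ => (2 * π)⁻¹ * ∫ θ in (0 : ℝ)..2 * π, fderiv ℝ φ (circleMap 0 ρ θ) (circleMap 0 1 θ) :=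
    ⟨_, rfl⟩
  have hMderiv : ∀ ρ : ℝ, HasDerivAt (Real.circleAverage φ 0) (M ρ) ρ := fun ρ => by
    rw [hM]; exact hasDerivAt_circleAverage_radius hφ ρ
  have hMc : Continuous M := by rw [hM]; exact continuous_circleAverage_radialDeriv hφ
  have hMint : ∀ ρ : ℝ, ∫ θ in (0 : ℝ)..2 * π, fderiv ℝ φ (circleMap 0 ρ θ) (circleMap 0 1 θ) =
      2 * π * M ρ := fun ρ => by
    rw [hM]; field_simp
  -- the clamped unit radial field `u z = z / max(‖z‖, w)` and the continuous surrogates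
  have hn0 : ∀ z : ℂ, max ‖z‖ w ≠ 0 := fun z => ne_of_gt (lt_max_of_lt_right hw)
  have huc : Continuous fun z : ℂ => (max ‖z‖ w)⁻¹ • z :=
    ((continuous_norm.max continuous_const).inv₀ hn0).smul continuous_id
  have hMn : Continuous fun z : ℂ => M ‖z‖ := hMc.comp continuous_norm
  have hSc : Continuous fun z : ℂ => fderiv ℝ φ z - M ‖z‖ • innerSL ℝ ((max ‖z‖ w)⁻¹ • z) :=
    hDc.sub (hMn.smul ((innerSL ℝ (E := ℂ)).continuous.comp huc))
  have hS2c : Continuous fun z : ℂ => ‖fderiv ℝ φ z - M ‖z‖ • innerSL ℝ ((max ‖z‖ w)⁻¹ • z)‖ ^ 2 :=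
    hSc.norm.pow 2
  have hHc : Continuous fun z : ℂ =>
      2 * M ‖z‖ * fderiv ℝ φ z ((max ‖z‖ w)⁻¹ • z) - M ‖z‖ ^ 2 :=
    ((continuous_const.mul hMn).mul (hDc.clm_apply huc)).sub (hMn.pow 2)
  have hF2c : Continuous fun z : ℂ => ‖fderiv ℝ φ z‖ ^ 2 := hDc.norm.pow 2
  -- facts on the annulus
  have hmem : ∀ z ∈ {z : ℂ | w ≤ ‖z‖ ∧ ‖z‖ ≤ r}, z ≠ 0 ∧ max ‖z‖ w = ‖z‖ ∧ ‖(max ‖z‖ w)⁻¹ • z‖ = 1 := by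
    intro z hz
    have hzn : 0 < ‖z‖ := hw.trans_le hz.1
    have hz0 : z ≠ 0 := norm_pos_iff.1 hzn
    have hmax : max ‖z‖ w = ‖z‖ := max_eq_left hz.1
    refine ⟨hz0, hmax, ?_⟩
    rw [hmax, norm_smul, norm_inv, norm_norm, inv_mul_cancel₀ hzn.ne']
  -- (b) the pointwise split on the annulus
  have hsplit : ∀ z ∈ {z : ℂ | w ≤ ‖z‖ ∧ ‖z‖ ≤ r}, ‖fderiv ℝ φ z‖ ^ 2 =
      ‖fderiv ℝ φ z - M ‖z‖ • innerSL ℝ ((max ‖z‖ w)⁻¹ • z)‖ ^ 2 +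
        (2 * M ‖z‖ * fderiv ℝ φ z ((max ‖z‖ w)⁻¹ • z) - M ‖z‖ ^ 2) := by
    intro z hz
    have h := opNorm_sq_eq_sub_radial (fderiv ℝ φ z) (hmem z hz).2.2 (M ‖z‖)
    linarith [h]
  -- (c) the deviation's derivative on the annulus
  have hdev : ∀ z ∈ {z : ℂ | w ≤ ‖z‖ ∧ ‖z‖ ≤ r},
      ‖fderiv ℝ (fun z => φ z - Real.circleAverage φ 0 ‖z‖) z‖ ^ 2 =
        ‖fderiv ℝ φ z - M ‖z‖ • innerSL ℝ ((max ‖z‖ w)⁻¹ • z)‖ ^ 2 := by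
    intro z hz
    obtain ⟨hz0, hmax, -⟩ := hmem z hz
    rw [fderiv_sub_radial hφd hz0 (hMderiv ‖z‖), hmax]
  -- integrability on the compact annulus
  have hK := isCompact_annulus w r
  have hmeas := measurableSet_annulus w r
  have hiS : IntegrableOn (fun z : ℂ => ‖fderiv ℝ φ z - M ‖z‖ • innerSL ℝ ((max ‖z‖ w)⁻¹ • z)‖ ^ 2)
      {z : ℂ | w ≤ ‖z‖ ∧ ‖z‖ ≤ r} := hS2c.continuousOn.integrableOn_compact hK
  have hiH : IntegrableOn (fun z : ℂ => 2 * M ‖z‖ * fderiv ℝ φ z ((max ‖z‖ w)⁻¹ • z) - M ‖z‖ ^ 2)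
      {z : ℂ | w ≤ ‖z‖ ∧ ‖z‖ ≤ r} := hHc.continuousOn.integrableOn_compact hK
  -- (g) the angular mean of the cross/radial term is `M ρ ^ 2`
  have hcircH : ∀ ρ ∈ uIcc w r,
      ρ * Real.circleAverage (fun z : ℂ => 2 * M ‖z‖ * fderiv ℝ φ z ((max ‖z‖ w)⁻¹ • z) - M ‖z‖ ^ 2) 0 ρ =
        ρ * M ρ ^ 2 := by
    intro ρ hρ
    rw [uIcc_of_le hwr] at hρ
    have hρpos : 0 < ρ := hw.trans_le hρ.1
    have hmax : max ρ w = ρ := max_eq_left hρ.1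
    have hpt : ∀ θ : ℝ, (max ‖circleMap 0 ρ θ‖ w)⁻¹ • circleMap 0 ρ θ = circleMap 0 1 θ := by
      intro θ
      rw [norm_circleMap_zero, abs_of_pos hρpos, hmax, circleMap_zero, circleMap_zero, Complex.real_smul,
        ← mul_assoc, ← Complex.ofReal_mul, inv_mul_cancel₀ hρpos.ne', Complex.ofReal_one]
    have hinteg : ∫ θ in (0 : ℝ)..2 * π,
        (2 * M ‖circleMap 0 ρ θ‖ * fderiv ℝ φ (circleMap 0 ρ θ) ((max ‖circleMap 0 ρ θ‖ w)⁻¹ • circleMap 0 ρ θ)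
          - M ‖circleMap 0 ρ θ‖ ^ 2) = 2 * π * M ρ ^ 2 := by
      have hfun : (fun θ : ℝ => 2 * M ‖circleMap 0 ρ θ‖ *
            fderiv ℝ φ (circleMap 0 ρ θ) ((max ‖circleMap 0 ρ θ‖ w)⁻¹ • circleMap 0 ρ θ) - M ‖circleMap 0 ρ θ‖ ^ 2) =
          fun θ : ℝ => 2 * M ρ * fderiv ℝ φ (circleMap 0 ρ θ) (circleMap 0 1 θ) - M ρ ^ 2 := by
        funext θ
        rw [hpt θ, norm_circleMap_zero, abs_of_pos hρpos]
      have hci : IntervalIntegrable (fun θ : ℝ => fderiv ℝ φ (circleMap 0 ρ θ) (circleMap 0 1 θ)) volume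
          0 (2 * π) :=
        ((continuous_radialIntegrand hφ).comp (continuous_const.prodMk continuous_id)).intervalIntegrable _ _
      rw [hfun, intervalIntegral.integral_sub (hci.const_mul _) intervalIntegrable_const,
        intervalIntegral.integral_const_mul, hMint ρ, intervalIntegral.integral_const, smul_eq_mul]
      ring
    rw [Real.circleAverage_def, smul_eq_mul, hinteg]
    field_simp
  -- assemble
  calc ∫ z in {z : ℂ | w ≤ ‖z‖ ∧ ‖z‖ ≤ r}, ‖fderiv ℝ φ z‖ ^ 2
      = ∫ z in {z : ℂ | w ≤ ‖z‖ ∧ ‖z‖ ≤ r},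
          (‖fderiv ℝ φ z - M ‖z‖ • innerSL ℝ ((max ‖z‖ w)⁻¹ • z)‖ ^ 2 +
            (2 * M ‖z‖ * fderiv ℝ φ z ((max ‖z‖ w)⁻¹ • z) - M ‖z‖ ^ 2)) :=
        setIntegral_congr_fun hmeas hsplit
    _ = (∫ z in {z : ℂ | w ≤ ‖z‖ ∧ ‖z‖ ≤ r}, ‖fderiv ℝ φ z - M ‖z‖ • innerSL ℝ ((max ‖z‖ w)⁻¹ • z)‖ ^ 2) +
          ∫ z in {z : ℂ | w ≤ ‖z‖ ∧ ‖z‖ ≤ r}, (2 * M ‖z‖ * fderiv ℝ φ z ((max ‖z‖ w)⁻¹ • z) - M ‖z‖ ^ 2) :=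
        integral_add hiS hiH
    _ = (∫ z in {z : ℂ | w ≤ ‖z‖ ∧ ‖z‖ ≤ r}, ‖fderiv ℝ (fun z => φ z - Real.circleAverage φ 0 ‖z‖) z‖ ^ 2) +
          2 * π * ∫ ρ in w..r, ρ * M ρ ^ 2 := by
        rw [setIntegral_congr_fun hmeas hdev, annulusIntegral_eq_integral_mul_circleAverage hHc hw hwr,
          intervalIntegral.integral_congr hcircH]
    _ = 2 * π * (∫ ρ in w..r, ρ * M ρ ^ 2) +
          ∫ z in {z : ℂ | w ≤ ‖z‖ ∧ ‖z‖ ≤ r}, ‖fderiv ℝ (fun z => φ z - Real.circleAverage φ 0 ‖z‖) z‖ ^ 2 := by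
        ring
    _ = _ := by rw [hM]

/-! ## §3 The one-dimensional identity and THEOREM G -/

/-- **The one-dimensional identity** behind the condenser Pythagoras: for continuous `M` on `[w, r]` (`0 < w < r`) with
`∫_w^r M = m_r − m_w`, `Λ = log(r/w)`, `Δ = m_w − m_r`:
`2π∫_w^r ρ M² = 2πΔ²/Λ + 2π∫_w^r (ρM + Δ/Λ)²/ρ` (expand the square; `∫_w^r ρ⁻¹ = Λ`). [folklore] -/
theorem radial_energy_identity {M : ℝ → ℝ} (hMc : Continuous M) {w r mw mr : ℝ} (hw : 0 < w) (hwr : w < r)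
    (hint : ∫ ρ in w..r, M ρ = mr - mw) :
    2 * π * ∫ ρ in w..r, ρ * M ρ ^ 2 =
      2 * π * (mw - mr) ^ 2 / Real.log (r / w) +
        2 * π * ∫ ρ in w..r, (ρ * M ρ + (mw - mr) / Real.log (r / w)) ^ 2 / ρ := by
  have hr : 0 < r := hw.trans hwr
  have hΛpos : 0 < Real.log (r / w) := Real.log_pos ((one_lt_div hw).2 hwr)
  generalize hΛ : Real.log (r / w) = Λ at hΛpos ⊢
  have hinv : ∫ ρ in w..r, ρ⁻¹ = Λ := by rw [integral_inv_of_pos hw hr, hΛ]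
  -- expand the square on `[w, r]`
  have hexp : ∫ ρ in w..r, (ρ * M ρ + (mw - mr) / Λ) ^ 2 / ρ =
      ∫ ρ in w..r, (ρ * M ρ ^ 2 + 2 * ((mw - mr) / Λ) * M ρ + ((mw - mr) / Λ) ^ 2 * ρ⁻¹) := by
    refine intervalIntegral.integral_congr fun ρ hρ => ?_
    rw [uIcc_of_le hwr.le] at hρ
    have hρ0 : ρ ≠ 0 := ne_of_gt (hw.trans_le hρ.1)
    field_simp
    ring
  have hi1 : IntervalIntegrable (fun ρ : ℝ => ρ * M ρ ^ 2) volume w r :=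
    (continuous_id.mul (hMc.pow 2)).intervalIntegrable _ _
  have hi2 : IntervalIntegrable (fun ρ : ℝ => 2 * ((mw - mr) / Λ) * M ρ) volume w r :=
    (continuous_const.mul hMc).intervalIntegrable _ _
  have hi3 : IntervalIntegrable (fun ρ : ℝ => ((mw - mr) / Λ) ^ 2 * ρ⁻¹) volume w r := by
    refine (continuousOn_const.mul (continuousOn_inv₀.mono ?_)).intervalIntegrable
    intro ρ hρ
    rw [uIcc_of_le hwr.le] at hρ
    exact ne_of_gt (hw.trans_le hρ.1)
  rw [hexp, intervalIntegral.integral_add (hi1.add hi2) hi3, intervalIntegral.integral_add hi1 hi2,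
    intervalIntegral.integral_const_mul, intervalIntegral.integral_const_mul, hint, hinv]
  field_simp
  ring

/-- **THEOREM G — CONDENSER PYTHAGORAS, explicit form.**  For `φ ∈ C¹(ℂ,ℝ)`, `0 < w < r`, `m(ρ) = ⨍_{‖z‖=ρ} φ`,
`Λ = log(r/w)`, `Δ = m(w) − m(r)`:
`ℰ_{w,r}[φ] = 2πΔ²/Λ + 2π∫_w^r (ρ m′(ρ) + Δ/Λ)² dρ/ρ + ℰ_{w,r}[φ − m∘‖·‖]`. [nsreg-p2 ROUND-44 THEOREM G; folklore] -/
theorem condenserPythagoras_explicit {φ : ℂ → ℝ} (hφ : ContDiff ℝ 1 φ) {w r : ℝ} (hw : 0 < w) (hwr : w < r) :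
    ∫ z in {z : ℂ | w ≤ ‖z‖ ∧ ‖z‖ ≤ r}, ‖fderiv ℝ φ z‖ ^ 2 =
      2 * π * (Real.circleAverage φ 0 w - Real.circleAverage φ 0 r) ^ 2 / Real.log (r / w)
        + 2 * π * (∫ ρ in w..r, (ρ * deriv (fun ρ : ℝ => Real.circleAverage φ 0 ρ) ρ
            + (Real.circleAverage φ 0 w - Real.circleAverage φ 0 r) / Real.log (r / w)) ^ 2 / ρ)
        + ∫ z in {z : ℂ | w ≤ ‖z‖ ∧ ‖z‖ ≤ r},
            ‖fderiv ℝ (fun z => φ z - Real.circleAverage φ 0 ‖z‖) z‖ ^ 2 := by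
  obtain ⟨M, hM⟩ : ∃ M : ℝ → ℝ,
      M = fun ρ => (2 * π)⁻¹ * ∫ θ in (0 : ℝ)..2 * π, fderiv ℝ φ (circleMap 0 ρ θ) (circleMap 0 1 θ) :=
    ⟨_, rfl⟩
  have hMc : Continuous M := by rw [hM]; exact continuous_circleAverage_radialDeriv hφ
  have hint : ∫ ρ in w..r, M ρ = Real.circleAverage φ 0 r - Real.circleAverage φ 0 w := by
    rw [hM]; exact integral_circleAverage_radialDeriv hφ w r
  have hderiv : deriv (fun ρ : ℝ => Real.circleAverage φ 0 ρ) = M := by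
    funext ρ; rw [hM]; exact deriv_circleAverage_radius hφ ρ
  have hsplit : ∫ z in {z : ℂ | w ≤ ‖z‖ ∧ ‖z‖ ≤ r}, ‖fderiv ℝ φ z‖ ^ 2 =
      2 * π * (∫ ρ in w..r, ρ * M ρ ^ 2)
        + ∫ z in {z : ℂ | w ≤ ‖z‖ ∧ ‖z‖ ≤ r}, ‖fderiv ℝ (fun z => φ z - Real.circleAverage φ 0 ‖z‖) z‖ ^ 2 := by
    rw [hM]; exact annulusEnergy_eq_radial_add_deviation hφ hw hwr.le
  rw [hsplit, hderiv, radial_energy_identity hMc hw hwr hint]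

/-- **THEOREM G — CONDENSER PYTHAGORAS** (nsreg-p2 ROUND-44 §3 (G); the statement is `NsregP2.R44.CondenserPythagoras`
of `r44/Sketch44b.lean` VERBATIM).  For `φ ∈ C¹(ℂ, ℝ)`, `0 < w < r`, `m(ρ)` the circular mean of `φ` on `‖z‖ = ρ`,
`Λ = log(r/w)`, `Δ = m(w) − m(r)`:
`ℰ_{w,r}[φ] = 2πΔ²/Λ + 2π∫_w^r (ρ m′(ρ) + Δ/Λ)² dρ/ρ + ℰ_{w,r}[φ − m∘‖·‖]`.
Hence `ℰ ≤ (1+ε)·2πΔ²/Λ` forces both deviation terms `≤ ε·2πΔ²/Λ`: a budget-saturating sheath is logarithmic in energy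
norm (equality-case stability of every capacity count in the tree). [nsreg-p2 ROUND-44 THEOREM G; folklore] -/
theorem condenserPythagoras :
    ∀ (φ : ℂ → ℝ), ContDiff ℝ 1 φ → ∀ (w r : ℝ), 0 < w → w < r →
      let m : ℝ → ℝ := fun ρ => Real.circleAverage φ 0 ρ
      let Λ : ℝ := Real.log (r / w)
      let Δ : ℝ := m w - m r
      ∫ z in {z : ℂ | w ≤ ‖z‖ ∧ ‖z‖ ≤ r}, ‖fderiv ℝ φ z‖ ^ 2 =
        2 * π * Δ ^ 2 / Λ + 2 * π * (∫ ρ in w..r, (ρ * deriv m ρ + Δ / Λ) ^ 2 / ρ)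
          + ∫ z in {z : ℂ | w ≤ ‖z‖ ∧ ‖z‖ ≤ r}, ‖fderiv ℝ (fun z => φ z - m ‖z‖) z‖ ^ 2 := by
  intro φ hφ w r hw hwr
  exact condenserPythagoras_explicit hφ hw hwr

end Summit.NavierStokesRegularity.NavierStokesRegularity.Theorems.PowerGaugeEulerLiouville.Condenser

end
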